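import Mathlib
import Summits.Ventures.CertifiedManyBodySolver.Theses.M3PrimeEdgeSplit

/-!
# Sketch 2 — «PSEUDO-HELLMANN–FEYNMAN DEFECT ROWS» (hub-lb-idea-11 g2, LINE idea11-L2;
crux idea for `M3PrimeEdgeSplit.LowerEdge_ge_m4o5`, stmt-Ventures-21721)

Diagnosis of LINE L1's death (VERDICT-14): `zeroGain_of_nested` needs the host feasible set to sit
inside the member's TILTED feasible set.  A member program whose stationarity (eom) rows — and Krylov
letters — are REGENERATED at the tilted Hamiltonian `H_s = H + s•K` has a tilt-dependent feasible set
`FM s`; the host optimum `x*` (stationary for `H`, not for `H_s`) is NOT in `FM s` as soon as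
`⟨[K,w]⟩_{x*} ≠ 0` for one eom word `w`.  Validity of the member row never needed nesting: it needs only
that the TRUE moment point satisfies it, which is the variational principle (`row_valid_of_variational`).
Whether the row CUTS is then decided by the cut depth `δ(s) = v(s) − v(0) − s·k*`; to second order
`δ(s) = −C s + ½ v″ s²` with `C = Σ_w μ*_w ⟨[K,w]⟩_{x*}` the pseudo-Hellmann–Feynman defect (envelope
theorem; analysis, not formalised here) and the best tilt gives `C²/(2|v″|)` (`cutDepth_le`, `cutDepth_at_opt`).
All statements below are abstract (sets of moment functionals), proved, no `sorry`.
-/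

namespace Summit.Ventures.CertifiedManyBodySolver.Cruxes.LowerEdge_ge_m4o5.PseudoHFDefectRows

/-- VALIDITY WITHOUT NESTING.  `L'` = a certified lower bound of the member program at the tilted
Hamiltonian (so `L' ≤ e0'`, the true tilted ground-state energy density); the variational principle
gives `e0' ≤ ω₀(H) + s·ω₀(K)` for the true `H`-ground state ω₀, whose moment point is `x0`.  Hence the row
`L' ≤ c x + s k x` holds at `x0`: it may be added to ANY valid host program at `H`. -/
theorem row_valid_of_variational {X : Type*} (c k : X → ℝ) (s L' e0' : ℝ) {x0 : X}
    (hmember : L' ≤ e0') (hvar : e0' ≤ c x0 + s * k x0) :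
    L' ≤ c x0 + s * k x0 :=
  le_trans hmember hvar

/-- Adding a row that the true point satisfies keeps the host a valid lower bound: the new host value
(min of `c` over `FH ∩ row`) is still `≤ c x0`. -/
theorem host_with_row_valid {X : Type*} (FH : Set X) (c k : X → ℝ) (s L' : ℝ) {x0 : X}
    (hx0 : x0 ∈ FH) (hrow : L' ≤ c x0 + s * k x0) (v' : ℝ)
    (hv' : ∀ x ∈ FH, L' ≤ c x + s * k x → v' ≤ c x) :
    v' ≤ c x0 :=
  hv' x0 hx0 hrow

/-- NON-NESTING WITNESS.  If the host optimum violates one of the member's tilted equality rows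
(`r x* ≠ 0` while every member-feasible point has `r = 0`), then `x* ∉ FM s` and no zero-gain theorem
applies; the row cuts iff `c x* + s k x* < L'` (definition of a cut). -/
theorem not_mem_of_row_violation {X : Type*} (FMs : Set X) (r : X → ℝ) {xstar : X}
    (hrows : ∀ x ∈ FMs, r x = 0) (hviol : r xstar ≠ 0) : xstar ∉ FMs :=
  fun h => hviol (hrows xstar h)

/-- CUT DEPTH, second-order model.  With `δ(s) = -C s + (v''/2) s²` and `v'' < 0`, every tilt gives at
most `C² / (2 (-v''))`. -/
theorem cutDepth_le (C v'' s : ℝ) (hv : v'' < 0) :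
    -C * s + v'' / 2 * s ^ 2 ≤ C ^ 2 / (2 * (-v'')) := by
  have hpos : 0 < 2 * (-v'') := by linarith
  rw [le_div_iff₀ hpos]
  nlinarith [sq_nonneg (v'' * s - C)]

/-- … and the optimum is attained at `s* = C / v''` (either sign of `C` cuts, on one side). -/
theorem cutDepth_at_opt (C v'' : ℝ) (hv : v'' ≠ 0) :
    -C * (C / v'') + v'' / 2 * (C / v'') ^ 2 = C ^ 2 / (2 * (-v'')) := by
  field_simp
  ring

/-- CHORD TEST (zero-solve screen at spacing Δ): the derived U-chord `½(v₋ + v₊)` beats the direct value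
`v₀` iff the three certified values are discretely CONVEX; for a pseudo-HF-consistent (concave) family
it never does. -/
theorem chord_beats_iff (vm v0 vp : ℝ) : v0 < (vm + vp) / 2 ↔ 0 < vm - 2 * v0 + vp := by
  constructor <;> intro h <;> linarith

/-- (glue a) A certified host floor `q ≤ e₀(8, 7/8, 0)` IS an `M3EnergyLowerRow 0 q`. -/
theorem row_of_floor (q : ℚ)
    (h : ((q : ℚ) : ℝ) ≤
      Literature.MathematicalPhysics.QuantumLattice.ThermodynamicLimit.energyDensityTT' 1 0 8 (7 / 8)) :
    M3EnergyLowerRow 0 q := by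
  unfold M3EnergyLowerRow
  exact h

/-- (glue b) Row → crux: any certified row at or above `-4/5` closes `LowerEdge_ge_m4o5`. -/
theorem lowerEdge_of_floor (q : ℚ) (hrow : M3EnergyLowerRow 0 q) (hge : (-4 / 5 : ℚ) ≤ q) :
    Theses.M3PrimeEdgeSplit.LowerEdge_ge_m4o5 :=
  ⟨q, hge, hrow⟩

end Summit.Ventures.CertifiedManyBodySolver.Cruxes.LowerEdge_ge_m4o5.PseudoHFDefectRows
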